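import Summits.AtomisticToContinuum.HydrodynamicLimit.Theorems.AntiMazurCoboundariesCorrectorPressureDecayKiferTangent
import Summits.AtomisticToContinuum.HydrodynamicLimit.Theorems.JParityClosureOddContactSymmetryGibbsInvariance

/-!
# Sanity of the tangent frame of line `FirstLemma` — crux stmt-AtomisticToContinuum-14135
`AntiMazurCoboundaries.CorrectorPressureDecay` ("X"); lead seat a1

The hypothesis frame of the wall `EntropicBoltzmannPropertyTangent` is INHABITED: the homogeneous Gibbs laws themselves, along any
hard-sphere flows and sizes `N k = k`, form a tangent family (`IsTangentFamily`) for every entropy budget `κ > 0` — relative entropy `0`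
and exact stationarity (`integral_comp_flow_localGibbsLaw_const`), hence `η`-almost stationarity at any rate. (Flows exist for
`σ < 1/2`: `CorrectorPressureDecayNegative.nonempty_flow`.) Tangent STATES of this family exist once `TangentTightness` is discharged; they
are the translation-invariant dilute Gibbs states, on which the wall holds with bias `0`.
-/

noncomputable section

open MeasureTheory Filter Topology

namespace Summit.AtomisticToContinuum.HydrodynamicLimit.Theorems.KiferCompactification

open Literature.MathematicalPhysics.KineticTheory (T3 V3 hsDiameter localGibbsLaw)
open Literature.Analysis.FluidPDE (HardSphereFlow Config)

/-- **Tangent families exist** (registered sanity stub `stub_isTangentFamily_gibbs`; non-vacuity of the wall's frame): for `σ ≤ 1/2`,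
`a, θ > 0` and ANY budget `κ`, the Gibbs laws `G_k` along any flows `Φ k` form a tangent family with `N k = k` (`KL = 0`; exact stationarity). -/
theorem stub_isTangentFamily_gibbs {σ : ℝ} (a θ : ℝ) (u₀ : V3) (κ : ℝ) (ha : 0 < a) (hθ : 0 < θ)
    (hσ2 : σ ≤ 1 / 2)
    (Φ : ∀ k : ℕ, HardSphereFlow (Literature.Analysis.FluidPDE.Torus.geometry (Fin 3)) (hsDiameter σ k) (k + 1)) :
    IsTangentFamily σ a θ u₀ κ (fun k => k) Φ
      (fun k => localGibbsLaw σ (fun _ => a) (fun _ => u₀) (fun _ => θ) k (Φ k)) := by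
  have hprob : ∀ k, IsProbabilityMeasure (localGibbsLaw σ (fun _ => a) (fun _ => u₀) (fun _ => θ) k (Φ k)) := fun k =>
    Literature.MathematicalPhysics.KineticTheory.isProbabilityMeasure_localGibbsLaw continuous_const continuous_const
      continuous_const (fun _ => ha) (fun _ => hθ) hσ2 k (Φ k)
  refine ⟨fun k => le_rfl, hprob, fun k => ?_, fun k => 1 / ((k : ℝ) + 1), tendsto_one_div_add_atTop_nhds_zero_nat,
    fun k f C hf hfC u hu => ?_⟩
  · haveI := hprob k
    rw [InformationTheory.klDiv_self]
    exact zero_le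
  · rw [Summit.AtomisticToContinuum.HydrodynamicLimit.Theorems.integral_comp_flow_localGibbsLaw_const σ a θ u₀ k (Φ k) u
      hf.aestronglyMeasurable, sub_self, abs_zero]
    have hC : 0 ≤ C := (abs_nonneg _).trans (hfC fun _ => ((0 : T3), (0 : V3)))
    positivity

end Summit.AtomisticToContinuum.HydrodynamicLimit.Theorems.KiferCompactification
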